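import Literature.AlgebraicGeometry.Motives.MumfordTateGroupDirectSum
import Mathlib.LinearAlgebra.TensorProduct.Pi
import HarnessLib

/-!
# `MT(Vⁿ) = MT(V)` acting diagonally: the reverse inclusion `Δ MT(V)(K) ⊆ MT(V ⊕ V)(K)`,
# `Δ MT(V)(K) ⊆ MT(V^{⊕ι})(K)`, and the resulting equalities on `K`-points and on `ℚ`-points
# (Moonen 2004 (4.10); Moonen 1999 (1.8), (1.13))

Layer `Literature/AlgebraicGeometry/Motives` (lane `lit-hodgefound`, Track 2 foundations library; seat
`lit-hodgefound-p34`, row g10-#1). THEOREMS plus plumbing definitions with bodies (family transport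
maps of tensor spaces, tensor powers of a family of morphisms, block-diagonal embeddings for finite
direct sums); no named fact is introduced (net debt 0). Sequel of `Motives/MumfordTateGroupDirectSum`
(row g9-#1), which proved the inclusions `MT(H ⊕ H)(K) ⊆ Δ MT(H)(K)`
(`mumfordTateGroupBaseChange_prod_self_le`) and "every `γ ∈ MT(H^{⊕ι})(K)` is `Σ_j (in_j)_K γ₀ (pr_j)_K`"
(`eq_sum_diag_of_mem_mumfordTateGroupBaseChange_pi_const`) and left the reverse inclusions open. They
are proved here, for the tree's tensor-stabiliser groups `MT(H)(K) = H.mumfordTateGroupBaseChange K`,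
`Hg(H)(K) = H.hodgeGroupBaseChange K` (the `K`-points of the stabilisers in `GL(K ⊗ V)` of the
rational Hodge tensors of weight `0` and type `(0,0)`, resp. of all types `(p,p)`, in the single
tensor spaces `T^{a,b} V = V^{⊗a} ⊗ (V^∨)^{⊗b}`; `Motives/EtaleTate`,
`Motives/HodgeStructureDeligneTorusMumfordTate`) and for the `ℚ`-points groups `H.mumfordTateGroup`,
`H.hodgeGroup` (`Motives/HodgeTensor`), for EVERY field `K ⊇ ℚ`.

## Sources, verbatim

* B. Moonen, *An introduction to Mumford–Tate groups* (lecture notes, 2004) [Moonen2004MT]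
  (materialised text `paper:url-8e52397fca11`, p. 9 L53–L54): "**(4.10) Exercise.** Let `V` be a
  `ℚ`-HS, purely of some weight `m`. If `n ⩾ 1`, show that `MT(Vⁿ) = MT(V)`, where we view `MT(V)`
  as a subgroup of `GL(Vⁿ)` through its diagonal action on `Vⁿ`."; p. 9 L10–L11: "**(4.6) Lemma.**
  If `V₁` and `V₂` are `ℚ`-HS then `MT(V₁ ⊕ V₂) ⊂ MT(V₁) × MT(V₂)` as subgroups of `GL(V₁ ⊕ V₂)`
  […] *Proof.* Immediate from the definition of the Mumford-Tate group."; p. 8, **(4.4)**: "an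
  element `t ∈ T^ν` is a Hodge class if and only if `t` is an invariant under `MT(V)`".
* B. Moonen, *Notes on Mumford–Tate groups* (Centre Émile Borel, 1999) [Moonen1999MTNotes]
  (materialised text `paper:url-c4d52097ebb3`, p. 4 L28), **(1.8)**: "Also, `MT(V^{⊕n})` (`n ≥ 1`)
  is isomorphic to `MT(V)` acting diagonally on `V^{⊕n}`."; p. 5 L19–L21, **(1.13)**: "Let `V₁` and
  `V₂` be `ℚ`-HS. Write `V := V₁ ⊕ V₂`. It readily follows from the definitions that
  `Hg(V) ⊆ Hg(V₁) × Hg(V₂)` […] if `V₁ = V₂` then `Hg(V)` is the diagonal subgroup of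
  `Hg(V₁) × Hg(V₂)`; see (1.8)."
* P. Deligne, *Hodge cycles on abelian varieties* (LNM 900, art. I) [Deligne1982HodgeCycles], §3.1
  (the tensor spaces `T^{a,b}` and the induced action of `GL(V)`), Prop. 3.4 (`MT` is the
  stabiliser of the Hodge tensors); P. Deligne, *Théorie de Hodge II* [DeligneHodgeII1971], 1.1.12
  (`⊗` is a functor of filtered objects), 2.1 (direct sums of Hodge structures).

## Mechanism (no Zariski closure; pure multilinear algebra)

For a decomposition of the identity `id_W = Σ_j in_j ∘ pr_j` of a module `W` through maps
`in_j : X → W`, `pr_j : W → X` (`j` in a finite index set), the multilinearity of `⊗_i f_i` in the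
family `(f_i)` (Mathlib's `PiTensorProduct.mapMultilinear` with `MultilinearMap.map_sum`) and of
`f ⊗ g` in `(f, g)` expands the identity of `T^{a,b} W` as
`id = Σ_{ε : Fin a → J} Σ_{δ : Fin b → J} T(in ∘ ε, pr ∘ δ) ∘ T(pr ∘ ε, in ∘ δ)` with the FAMILY
transport `T(f, g) := (⊗_i f_i) ⊗ (⊗_j g_jᵀ)` (`sum_tensorSpaceMapOverFamily_eq_id`). If an
automorphism `γ` of `W` and an automorphism `γ₁` of `X` satisfy `γ ∘ in_j = in_j ∘ γ₁`,
`pr_j ∘ γ = γ₁ ∘ pr_j` (a "block-scalar" `γ`), the action `ρ(γ) = γ^{⊗a} ⊗ (γ⁻ᵀ)^{⊗b}` satisfies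
`ρ(γ) ∘ T(in ∘ ε, pr ∘ δ) = T(in ∘ ε, pr ∘ δ) ∘ ρ(γ₁)`; so `ρ(γ)` fixes `s` as soon as `ρ(γ₁)` fixes
every component `T(pr ∘ ε, in ∘ δ) s` (`tensorSpaceActOver_eq_self_of_forall_blocks`). For Hodge
structures `H` on `V`, `H'` on `W` and MORPHISMS `in_j : H → H'`, `pr_j : H' → H`, each component of a
Hodge tensor of `H'` is a Hodge tensor of `H` of the same type (`tensorSpaceMapOverFamily_mem_hodgeClasses`,
through `Hom.tensorSpaceMapFamily`, the tensor product of the tensor powers of the families), fixed by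
`γ₁ ∈ MT(H)(K)` after extension of scalars (`tensorSpaceToBaseChange_tensorSpaceMapOverFamily`);
hence `γ ∈ MT(H')(K)` (`mem_mumfordTateGroupBaseChange_of_blocks`).

## What is proved

* §1 (linear algebra over a field `K`): `tensorSpaceMapOverFamily f g` and its functoriality,
  naturality for the group action (`tensorSpaceMapOverFamily_tensorSpaceActOver`), the expansion of
  the identity (`sum_tensorSpaceMapOverFamily_eq_id`) and the transfer of invariance
  (`tensorSpaceActOver_eq_self_of_forall_blocks`); §1b base change; §1c the block-diagonal
  embedding `piBlockDiag K W : (Π_j GL(K ⊗ W_j)) →* GL(K ⊗ Π_j W_j)` over Mathlib's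
  `TensorProduct.piRight` (`coe_piBlockDiag : piBlockDiag γ = Σ_j (in_j)_K γ_j (pr_j)_K`) and the
  diagonal `piDiagEmbedding K V ι : GL(K ⊗ V) →* GL(K ⊗ (ι → V))`.
* §2 (Hodge structures): `Hom.tensorPowerMapFamily` — `⊗_i f_i : H₁^{⊗k} → H₂^{⊗k}` is a morphism for
  a family of morphisms `f_i : H₁ → H₂` (Deligne, Hodge II, 1.1.12); `Hom.tensorSpaceMapFamily`.
* §3 **`mem_mumfordTateGroupBaseChange_of_blocks`** / **`mem_hodgeGroupBaseChange_of_blocks`** (the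
  mechanism above, `K`-points) and **`mem_mumfordTateGroup_of_blocks`** / **`mem_hodgeGroup_of_blocks`**
  (`ℚ`-points).
* §4 **Moonen (4.10) for `n = 2` / (1.13), on `K`-points, as EQUALITIES**:
  `diagEmbedding_mem_mumfordTateGroupBaseChange` (`γ ⊕ γ ∈ MT(H ⊕ H)(K)` for `γ ∈ MT(H)(K)`),
  **`mumfordTateGroupBaseChange_prod_self_eq : MT(H ⊕ H)(K) = Δ MT(H)(K)`**,
  **`hodgeGroupBaseChange_prod_self_eq : Hg(H ⊕ H)(K) = Δ Hg(H)(K)`**.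
* §5 **Moonen (4.10) / (1.8) for `V^{⊕ι}`, `ι` finite nonempty, on `K`-points**:
  `piDiagEmbedding_mem_mumfordTateGroupBaseChange`,
  **`mumfordTateGroupBaseChange_pi_const_eq : MT(H^{⊕ι})(K) = Δ MT(H)(K)`**,
  **`hodgeGroupBaseChange_pi_const_eq`**; and the general-family restatement of g9's §5,
  `mumfordTateGroupBaseChange_pi_le : MT(⊕_j H_j)(K) ≤ (Π_j MT(H_j)(K)).map piBlockDiag` (Moonen (4.6)
  for finitely many summands, inclusion only).
* §6 **`ℚ`-points**: `prodCongr_mem_mumfordTateGroup_iff : g ⊕ g ∈ MT(H ⊕ H) ↔ g ∈ MT(H)`,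
  `mem_mumfordTateGroup_prod_self_iff : g' ∈ MT(H ⊕ H) ↔ ∃ g ∈ MT(H), g' = g ⊕ g`, and the `Hg` twins.

Not claimed: Moonen (4.6) second clause (surjectivity of `prᵢ` for MIXED sums `V₁ ⊕ V₂`) — for
`γᵢ ∈ MT(Hᵢ)(K)` the block sum `γ₁ ⊕ γ₂` need not lie in `MT(H₁ ⊕ H₂)(K)` (Moonen 1999 (1.13): "In
general the Hodge group `Hg(V)` need not be equal to the product group").
-/

noncomputable section

open scoped TensorProduct PiTensorProduct

namespace Literature.AlgebraicGeometry.Motives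

/-! ### §1 Family transport maps `T(f, g) = (⊗_i f_i) ⊗ (⊗_j g_jᵀ)` and the expansion of the identity -/

section LinearAlgebra

universe uK u₁ u₂ u₃

variable {K : Type uK} [Field K] {W₁ : Type u₁} [AddCommGroup W₁] [Module K W₁]
  {W : Type u₂} [AddCommGroup W] [Module K W] {W' : Type u₃} [AddCommGroup W'] [Module K W']

/-- The **family transport map** `T(f, g) = (⊗_i f_i) ⊗ (⊗_j g_jᵀ) : T^{a,b}_K W₁ → T^{a,b}_K W` of
families of linear maps `f_i : W₁ → W` (`i < a`) and `g_j : W → W₁` (`j < b`): Deligne's `T^{a,b}`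
(LNM 900, I §3.1) is a functor of the module, and `⊗` is multi-functorial factor by factor; for
constant families this is the tree's `tensorSpaceMapOver f g a b` (`tensorSpaceMapOverFamily_const`).
[cite: Deligne1982HodgeCycles, I §3.1] -/
def tensorSpaceMapOverFamily {a b : ℕ} (f : Fin a → (W₁ →ₗ[K] W)) (g : Fin b → (W →ₗ[K] W₁)) :
    hodgeTensorSpaceOver K W₁ a b →ₗ[K] hodgeTensorSpaceOver K W a b :=
  TensorProduct.map (PiTensorProduct.map f) (PiTensorProduct.map fun j => (g j).dualMap)

/-- `T(f, g)` on pure tensors: `(⊗ wᵢ) ⊗ (⊗ φⱼ) ↦ (⊗ fᵢ wᵢ) ⊗ (⊗ φⱼ ∘ gⱼ)`. [cite: Deligne1982HodgeCycles, I §3.1] -/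
@[simp]
theorem tensorSpaceMapOverFamily_tprod_tmul_tprod {a b : ℕ} (f : Fin a → (W₁ →ₗ[K] W))
    (g : Fin b → (W →ₗ[K] W₁)) (w : Fin a → W₁) (φ : Fin b → Module.Dual K W₁) :
    tensorSpaceMapOverFamily f g (PiTensorProduct.tprod K w ⊗ₜ[K] PiTensorProduct.tprod K φ) =
      (PiTensorProduct.tprod K fun i => f i (w i)) ⊗ₜ[K]
        PiTensorProduct.tprod K fun j => (φ j).comp (g j) := by
  simp only [tensorSpaceMapOverFamily, TensorProduct.map_tmul, PiTensorProduct.map_tprod]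
  rfl

/-- For constant families, `T(f, g)` is the tree's `tensorSpaceMapOver f g a b = f^{⊗a} ⊗ (gᵀ)^{⊗b}`
(by `rfl`). [cite: Deligne1982HodgeCycles, I §3.1] -/
theorem tensorSpaceMapOverFamily_const {a b : ℕ} (f : W₁ →ₗ[K] W) (g : W →ₗ[K] W₁) :
    tensorSpaceMapOverFamily (fun _ : Fin a => f) (fun _ : Fin b => g) = tensorSpaceMapOver f g a b :=
  rfl

/-- **Functoriality, factor by factor**: `T(f', g') ∘ T(f, g) = T((f'_i ∘ f_i)_i, (g_j ∘ g'_j)_j)`.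
[cite: Deligne1982HodgeCycles, I §3.1] -/
theorem tensorSpaceMapOverFamily_comp {a b : ℕ} (f : Fin a → (W₁ →ₗ[K] W))
    (g : Fin b → (W →ₗ[K] W₁)) (f' : Fin a → (W →ₗ[K] W')) (g' : Fin b → (W' →ₗ[K] W)) :
    tensorSpaceMapOverFamily f' g' ∘ₗ tensorSpaceMapOverFamily f g =
      tensorSpaceMapOverFamily (fun i => f' i ∘ₗ f i) (fun j => g j ∘ₗ g' j) := by
  rw [tensorSpaceMapOverFamily, tensorSpaceMapOverFamily, tensorSpaceMapOverFamily,
    ← TensorProduct.map_comp, ← PiTensorProduct.map_comp, ← PiTensorProduct.map_comp]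
  rfl

/-- `T(f', g') (T(f, g) t) = T((f'_i ∘ f_i), (g_j ∘ g'_j)) t`. [cite: Deligne1982HodgeCycles, I §3.1] -/
theorem tensorSpaceMapOverFamily_tensorSpaceMapOverFamily {a b : ℕ} (f : Fin a → (W₁ →ₗ[K] W))
    (g : Fin b → (W →ₗ[K] W₁)) (f' : Fin a → (W →ₗ[K] W')) (g' : Fin b → (W' →ₗ[K] W))
    (t : hodgeTensorSpaceOver K W₁ a b) :
    tensorSpaceMapOverFamily f' g' (tensorSpaceMapOverFamily f g t) =
      tensorSpaceMapOverFamily (fun i => f' i ∘ₗ f i) (fun j => g j ∘ₗ g' j) t := by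
  rw [← LinearMap.comp_apply, tensorSpaceMapOverFamily_comp]

/-- **Naturality of the group action along a family of intertwining pairs**: if `f_i γ₁ = γ f_i` for
all `i` and `γ₁⁻¹ g_j = g_j γ⁻¹` for all `j`, then `T(f, g) (ρ(γ₁) t) = ρ(γ) (T(f, g) t)` (the tree's
`ρ(γ) = T(γ, γ⁻¹)`, `coe_tensorSpaceActOver_eq_tensorSpaceMapOver`, and functoriality).
[cite: Deligne1982HodgeCycles, I §3.1] -/
theorem tensorSpaceMapOverFamily_tensorSpaceActOver {a b : ℕ} (f : Fin a → (W₁ →ₗ[K] W))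
    (g : Fin b → (W →ₗ[K] W₁)) {γ₁ : W₁ ≃ₗ[K] W₁} {γ : W ≃ₗ[K] W}
    (hf : ∀ i, f i ∘ₗ (γ₁ : W₁ →ₗ[K] W₁) = (γ : W →ₗ[K] W) ∘ₗ f i)
    (hg : ∀ j, (γ₁.symm : W₁ →ₗ[K] W₁) ∘ₗ g j = g j ∘ₗ (γ.symm : W →ₗ[K] W))
    (t : hodgeTensorSpaceOver K W₁ a b) :
    tensorSpaceMapOverFamily f g (tensorSpaceActOver γ₁ t) =
      tensorSpaceActOver γ (tensorSpaceMapOverFamily f g t) := by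
  have h₁ : tensorSpaceMapOverFamily f g ∘ₗ
        (tensorSpaceActOver (a := a) (b := b) γ₁ : hodgeTensorSpaceOver K W₁ a b →ₗ[K] _) =
      (tensorSpaceActOver (a := a) (b := b) γ : hodgeTensorSpaceOver K W a b →ₗ[K] _) ∘ₗ
        tensorSpaceMapOverFamily f g := by
    rw [coe_tensorSpaceActOver_eq_tensorSpaceMapOver, coe_tensorSpaceActOver_eq_tensorSpaceMapOver,
      ← tensorSpaceMapOverFamily_const, ← tensorSpaceMapOverFamily_const, tensorSpaceMapOverFamily_comp,
      tensorSpaceMapOverFamily_comp]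
    have hf' : (fun i => f i ∘ₗ (γ₁ : W₁ →ₗ[K] W₁)) = fun i => (γ : W →ₗ[K] W) ∘ₗ f i := funext hf
    have hg' : (fun j => (γ₁.symm : W₁ →ₗ[K] W₁) ∘ₗ g j) = fun j => g j ∘ₗ (γ.symm : W →ₗ[K] W) :=
      funext hg
    rw [hf', hg']
  exact LinearMap.congr_fun h₁ t

omit [AddCommGroup W'] [Module K W'] in
/-- **Multilinearity of `⊗_i` in the family**: `⊗_i (Σ_j e_{i,j}) = Σ_{r} ⊗_i e_{i, r i}` (Mathlib's
`PiTensorProduct.mapMultilinear` with `MultilinearMap.map_sum`). [folklore] -/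
private theorem piTensorProduct_map_sum_family {ι' : Type*} [Fintype ι'] [DecidableEq ι'] {J : Type*}
    [Fintype J] (e : ι' → J → (W₁ →ₗ[K] W)) :
    PiTensorProduct.map (R := K) (fun i => ∑ j, e i j) =
      ∑ r : ι' → J, PiTensorProduct.map (R := K) (fun i => e i (r i)) := by
  have h := (PiTensorProduct.mapMultilinear K (fun _ : ι' => W₁) (fun _ : ι' => W)).map_sum e
  simpa only [PiTensorProduct.mapMultilinear_apply] using h

omit [AddCommGroup W₁] [Module K W₁] [AddCommGroup W'] [Module K W'] in
/-- **Bilinearity of `⊗`**: `(Σ_ε A_ε) ⊗ (Σ_δ B_δ) = Σ_ε Σ_δ A_ε ⊗ B_δ` for linear maps (Mathlib's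
`TensorProduct.mapBilinear`). [folklore] -/
private theorem tensorProduct_map_sum_sum {M₁ M₂ N₁ N₂ : Type*} [AddCommMonoid M₁] [Module K M₁]
    [AddCommMonoid M₂] [Module K M₂] [AddCommMonoid N₁] [Module K N₁] [AddCommMonoid N₂] [Module K N₂]
    {E : Type*} [Fintype E] {D : Type*} [Fintype D] (A : E → (M₁ →ₗ[K] M₂)) (B : D → (N₁ →ₗ[K] N₂)) :
    TensorProduct.map (∑ ε, A ε) (∑ δ, B δ) = ∑ ε, ∑ δ, TensorProduct.map (A ε) (B δ) := by
  rw [← TensorProduct.mapBilinear_apply,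
    map_sum (TensorProduct.mapBilinear (RingHom.id K) M₁ N₁ M₂ N₂) A Finset.univ, LinearMap.sum_apply]
  refine Finset.sum_congr rfl fun ε _ => ?_
  rw [map_sum]
  rfl

omit [AddCommGroup W₁] [Module K W₁] [AddCommGroup W'] [Module K W'] in
/-- **Expansion of the identity of `T^{a,b} W` along a decomposition `id_W = Σ_j e_j`**:
`Σ_{ε : Fin a → J} Σ_{δ : Fin b → J} T((e_{ε i})_i, (e_{δ j})_j) = id` (multilinearity of `⊗_i` and
`⊗`, additivity of the transpose, `⊗_i id = id`). With `e_j = in_j ∘ pr_j` the summands factor as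
`T(in ∘ ε, pr ∘ δ) ∘ T(pr ∘ ε, in ∘ δ)` — the decomposition of `T^{a,b}(⊕_j X)` into copies of `T^{a,b} X`
used in Moonen's "immediate from the definition". [cite: Moonen2004MT, §4 Lemma 4.6 and Exercise 4.10]
[cite: Deligne1982HodgeCycles, I §3.1] -/
theorem sum_tensorSpaceMapOverFamily_eq_id {J : Type*} [Fintype J] (e : J → (W →ₗ[K] W))
    (he : ∑ j, e j = LinearMap.id) (a b : ℕ) :
    ∑ ε : Fin a → J, ∑ δ : Fin b → J,
        tensorSpaceMapOverFamily (fun i => e (ε i)) (fun j => e (δ j)) =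
      (LinearMap.id : hodgeTensorSpaceOver K W a b →ₗ[K] hodgeTensorSpaceOver K W a b) := by
  have h₁ : ∑ ε : Fin a → J, PiTensorProduct.map (R := K) (fun i => e (ε i)) =
      PiTensorProduct.map fun _ : Fin a => (LinearMap.id : W →ₗ[K] W) := by
    rw [← piTensorProduct_map_sum_family (fun (_ : Fin a) (j : J) => e j), he]
  have hdual : ∑ j, (e j).dualMap = (LinearMap.id : Module.Dual K W →ₗ[K] Module.Dual K W) := by
    rw [← LinearMap.dualMap_id, ← he]
    simp only [LinearMap.dualMap_def, map_sum]
  have h₂ : ∑ δ : Fin b → J, PiTensorProduct.map (R := K) (fun j => (e (δ j)).dualMap) =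
      PiTensorProduct.map fun _ : Fin b => (LinearMap.id : Module.Dual K W →ₗ[K] Module.Dual K W) := by
    rw [← piTensorProduct_map_sum_family (fun (_ : Fin b) (j : J) => (e j).dualMap), hdual]
  calc ∑ ε : Fin a → J, ∑ δ : Fin b → J,
        tensorSpaceMapOverFamily (fun i => e (ε i)) (fun j => e (δ j))
      = TensorProduct.map (∑ ε : Fin a → J, PiTensorProduct.map (R := K) (fun i => e (ε i)))
          (∑ δ : Fin b → J, PiTensorProduct.map (R := K) (fun j => (e (δ j)).dualMap)) := by
        rw [tensorProduct_map_sum_sum]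
        rfl
    _ = LinearMap.id := by
        rw [h₁, h₂, PiTensorProduct.map_id, PiTensorProduct.map_id, TensorProduct.map_id]

/-- **Transfer of invariance from the blocks to a block-scalar automorphism.** Let
`id_W = Σ_j in_j ∘ pr_j` (`in_j : W₁ → W`, `pr_j : W → W₁`), and let automorphisms `γ₁` of `W₁`, `γ` of
`W` satisfy `in_j γ₁ = γ in_j`, `pr_j γ = γ₁ pr_j` for all `j`. If `ρ(γ₁)` fixes every component
`T(pr ∘ ε, in ∘ δ) s ∈ T^{a,b}_K W₁` of `s ∈ T^{a,b}_K W`, then `ρ(γ)` fixes `s`: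
`ρ(γ) s = Σ ρ(γ) T(in ε, pr δ) T(pr ε, in δ) s = Σ T(in ε, pr δ) ρ(γ₁) T(pr ε, in δ) s = s`.
This is the multilinear core of Moonen's (4.10) "`MT(Vⁿ) = MT(V)` […] through its diagonal action".
[cite: Moonen2004MT, §4 Exercise 4.10] [cite: Moonen1999MTNotes, (1.8)] -/
theorem tensorSpaceActOver_eq_self_of_forall_blocks {J : Type*} [Fintype J]
    (inj : J → (W₁ →ₗ[K] W)) (pr : J → (W →ₗ[K] W₁))
    (hsum : ∑ j, inj j ∘ₗ pr j = LinearMap.id) {γ₁ : W₁ ≃ₗ[K] W₁} {γ : W ≃ₗ[K] W}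
    (hinj : ∀ j, inj j ∘ₗ (γ₁ : W₁ →ₗ[K] W₁) = (γ : W →ₗ[K] W) ∘ₗ inj j)
    (hpr : ∀ j, pr j ∘ₗ (γ : W →ₗ[K] W) = (γ₁ : W₁ →ₗ[K] W₁) ∘ₗ pr j) {a b : ℕ}
    {s : hodgeTensorSpaceOver K W a b}
    (hs : ∀ (ε : Fin a → J) (δ : Fin b → J),
      tensorSpaceActOver γ₁ (tensorSpaceMapOverFamily (fun i => pr (ε i)) (fun j => inj (δ j)) s) =
        tensorSpaceMapOverFamily (fun i => pr (ε i)) (fun j => inj (δ j)) s) :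
    tensorSpaceActOver γ s = s := by
  -- the inverse form of `hpr`: `γ₁⁻¹ pr_j = pr_j γ⁻¹`
  have hpr' : ∀ j, (γ₁.symm : W₁ →ₗ[K] W₁) ∘ₗ pr j = pr j ∘ₗ (γ.symm : W →ₗ[K] W) := by
    intro j
    refine LinearMap.ext fun x => ?_
    simp only [LinearMap.coe_comp, Function.comp_apply, LinearEquiv.coe_coe]
    rw [LinearEquiv.symm_apply_eq]
    have h := LinearMap.congr_fun (hpr j) (γ.symm x)
    simp only [LinearMap.coe_comp, Function.comp_apply, LinearEquiv.coe_coe,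
      LinearEquiv.apply_symm_apply] at h
    exact h
  have hexp := sum_tensorSpaceMapOverFamily_eq_id (fun j => inj j ∘ₗ pr j) hsum a b
  have hcomp : ∀ (ε : Fin a → J) (δ : Fin b → J),
      tensorSpaceMapOverFamily (fun i => inj (ε i) ∘ₗ pr (ε i)) (fun j => inj (δ j) ∘ₗ pr (δ j)) =
        tensorSpaceMapOverFamily (fun i => inj (ε i)) (fun j => pr (δ j)) ∘ₗ
          tensorSpaceMapOverFamily (a := a) (b := b) (fun i => pr (ε i)) (fun j => inj (δ j)) :=
    fun ε δ => (tensorSpaceMapOverFamily_comp _ _ _ _).symm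
  have hnat : ∀ (ε : Fin a → J) (δ : Fin b → J) (t : hodgeTensorSpaceOver K W₁ a b),
      tensorSpaceMapOverFamily (fun i => inj (ε i)) (fun j => pr (δ j)) (tensorSpaceActOver γ₁ t) =
        tensorSpaceActOver γ (tensorSpaceMapOverFamily (fun i => inj (ε i)) (fun j => pr (δ j)) t) :=
    fun ε δ t => tensorSpaceMapOverFamily_tensorSpaceActOver _ _ (fun i => hinj (ε i))
      (fun j => hpr' (δ j)) t
  have hs' : s = ∑ ε : Fin a → J, ∑ δ : Fin b → J,
      tensorSpaceMapOverFamily (fun i => inj (ε i)) (fun j => pr (δ j))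
        (tensorSpaceMapOverFamily (fun i => pr (ε i)) (fun j => inj (δ j)) s) := by
    have h := LinearMap.congr_fun hexp s
    simp only [LinearMap.sum_apply, LinearMap.id_apply, hcomp, LinearMap.comp_apply] at h
    exact h.symm
  conv_lhs => rw [hs']
  simp only [map_sum, ← hnat, hs]
  exact hs'.symm

end LinearAlgebra

/-! ### §1b Base change of the family transport maps -/

section BaseChange

universe uK u

variable (K : Type uK) [Field K] [Algebra ℚ K] {V₁ : Type u} [AddCommGroup V₁] [Module ℚ V₁]
  {V : Type u} [AddCommGroup V] [Module ℚ V]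

/-- Base change of a pulled-back functional: `(φ ∘ g)_K = φ_K ∘ g_K`. Private plumbing. [folklore] -/
private theorem dualBaseChange_comp_linearMap' (φ : Module.Dual ℚ V₁) (g : V →ₗ[ℚ] V₁) :
    Module.Dual.baseChange K (φ ∘ₗ g) = (Module.Dual.baseChange K φ) ∘ₗ g.baseChange K := by
  ext v
  simp

/-- **The family transport maps commute with extension of scalars**:
`ι_K (T(f, g) t) = T((f_i)_K, (g_j)_K) (ι_K t)` for the tree's comparison maps
`ι_K = tensorSpaceToBaseChange K` (checked on pure tensors). [cite: Deligne1982HodgeCycles, I §3.1] -/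
theorem tensorSpaceToBaseChange_tensorSpaceMapOverFamily {a b : ℕ} (f : Fin a → (V₁ →ₗ[ℚ] V))
    (g : Fin b → (V →ₗ[ℚ] V₁)) (t : hodgeTensorSpace V₁ a b) :
    tensorSpaceToBaseChange K V a b (tensorSpaceMapOverFamily f g t) =
      tensorSpaceMapOverFamily (fun i => (f i).baseChange K) (fun j => (g j).baseChange K)
        (tensorSpaceToBaseChange K V₁ a b t) := by
  suffices h : tensorSpaceToBaseChange K V a b ∘ₗ tensorSpaceMapOverFamily f g =
      ((tensorSpaceMapOverFamily (fun i => (f i).baseChange K) (fun j => (g j).baseChange K)).restrictScalars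
          ℚ) ∘ₗ tensorSpaceToBaseChange K V₁ a b from
    LinearMap.congr_fun h t
  ext v φ
  simp [dualBaseChange_comp_linearMap']

/-- Base change of a finite sum of composites: `Σ_j (f_j)_K ∘ (g_j)_K = (Σ_j f_j ∘ g_j)_K` (the middle
module may depend on `j`). [folklore] -/
private theorem sum_baseChange_comp_baseChange {J : Type*} [Fintype J] {U : Type*} [AddCommGroup U]
    [Module ℚ U] {X : J → Type*} [∀ j, AddCommGroup (X j)] [∀ j, Module ℚ (X j)]
    (f : ∀ j, X j →ₗ[ℚ] U) (g : ∀ j, V →ₗ[ℚ] X j) :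
    ∑ j, (f j).baseChange K ∘ₗ (g j).baseChange K = (∑ j, f j ∘ₗ g j).baseChange K := by
  have h : ∀ j, (f j).baseChange K ∘ₗ (g j).baseChange K = (f j ∘ₗ g j).baseChange K := fun j =>
    (LinearMap.baseChange_comp (g j) (f j)).symm
  simp only [h]
  have hs := map_sum (LinearMap.baseChangeHom ℚ K V U) (fun j => f j ∘ₗ g j) Finset.univ
  simp only [LinearMap.baseChangeHom_apply] at hs
  exact hs.symm

end BaseChange

/-! ### §1c Block-diagonal and diagonal embeddings for finite direct sums `K ⊗ (Π_j W_j)` -/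

section PiBlockDiag

universe uK u

variable (K : Type uK) [Field K] [Algebra ℚ K] {ι : Type} [Fintype ι] [DecidableEq ι]
  (W : ι → Type u) [∀ j, AddCommGroup (W j)] [∀ j, Module ℚ (W j)]

/-- **The block-diagonal embedding `Π_j GL(K ⊗ W_j) →* GL(K ⊗ Π_j W_j)`**, `(γ_j)_j ↦ ⊕_j γ_j`, through
Mathlib's `TensorProduct.piRight : K ⊗ (Π_j W_j) ≃ Π_j (K ⊗ W_j)` (the subgroup `Π MT(V_i) ⊂ GL(⊕ V_i)`
of Moonen's Lemma 4.6 for finitely many summands, on `K`-points). [cite: Moonen2004MT, §4 Lemma 4.6] -/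
def piBlockDiag :
    (∀ j, (K ⊗[ℚ] W j) ≃ₗ[K] (K ⊗[ℚ] W j)) →* ((K ⊗[ℚ] (∀ j, W j)) ≃ₗ[K] (K ⊗[ℚ] (∀ j, W j))) where
  toFun γ := (TensorProduct.piRight ℚ K K W).trans
    ((LinearEquiv.piCongrRight γ).trans (TensorProduct.piRight ℚ K K W).symm)
  map_one' := by
    refine LinearEquiv.ext fun x => ?_
    simp only [LinearEquiv.trans_apply]
    have h : (LinearEquiv.piCongrRight (1 : ∀ j, (K ⊗[ℚ] W j) ≃ₗ[K] (K ⊗[ℚ] W j)))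
        (TensorProduct.piRight ℚ K K W x) = TensorProduct.piRight ℚ K K W x := by
      funext j
      rw [LinearEquiv.piCongrRight_apply, Pi.one_apply, LinearEquiv.coe_one, id_eq]
    rw [h, LinearEquiv.symm_apply_apply, LinearEquiv.coe_one, id_eq]
  map_mul' γ γ' := by
    refine LinearEquiv.ext fun x => ?_
    simp only [LinearEquiv.trans_apply, LinearEquiv.mul_apply, LinearEquiv.apply_symm_apply]
    congr 1

variable {K W} in
/-- `(piRight x) j = (pr_j)_K x`. Private plumbing. [folklore] -/
private theorem piRight_apply_eq_proj_baseChange (x : K ⊗[ℚ] (∀ j, W j)) (j : ι) :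
    TensorProduct.piRight ℚ K K W x j = (LinearMap.proj j : (∀ k, W k) →ₗ[ℚ] W j).baseChange K x := by
  induction x using TensorProduct.induction_on with
  | zero => simp
  | tmul c v => simp [LinearMap.baseChange_tmul]
  | add x y hx hy => rw [map_add, Pi.add_apply, hx, hy, map_add]

variable {K W} in
/-- `piRight.symm (Pi.single j z) = (in_j)_K z`. Private plumbing. [folklore] -/
private theorem piRight_symm_single_eq_single_baseChange (j : ι) (z : K ⊗[ℚ] W j) :
    (TensorProduct.piRight ℚ K K W).symm (Pi.single j z) = (LinearMap.single ℚ W j).baseChange K z := by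
  induction z using TensorProduct.induction_on with
  | zero => rw [Pi.single_zero, map_zero, map_zero]
  | tmul c w =>
    rw [TensorProduct.piRight_symm_single, LinearMap.baseChange_tmul, LinearMap.coe_single]
  | add z z' hz hz' => rw [Pi.single_add, map_add, hz, hz', map_add]

variable {K W} in
/-- `piRight.symm y = Σ_j (in_j)_K (y j)`. Private plumbing. [folklore] -/
private theorem piRight_symm_eq_sum (y : ∀ j, K ⊗[ℚ] W j) :
    (TensorProduct.piRight ℚ K K W).symm y = ∑ j, (LinearMap.single ℚ W j).baseChange K (y j) := by
  conv_lhs => rw [← Finset.univ_sum_single y]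
  rw [map_sum]
  exact Finset.sum_congr rfl fun j _ => piRight_symm_single_eq_single_baseChange j (y j)

variable {K W} in
/-- **The block-diagonal automorphism as a linear map**: `piBlockDiag γ = Σ_j (in_j)_K γ_j (pr_j)_K`.
[cite: Moonen2004MT, §4 Lemma 4.6] -/
theorem coe_piBlockDiag (γ : ∀ j, (K ⊗[ℚ] W j) ≃ₗ[K] (K ⊗[ℚ] W j)) :
    (piBlockDiag K W γ : K ⊗[ℚ] (∀ j, W j) →ₗ[K] K ⊗[ℚ] (∀ j, W j)) =
      ∑ j, (LinearMap.single ℚ W j).baseChange K ∘ₗ (γ j : K ⊗[ℚ] W j →ₗ[K] K ⊗[ℚ] W j) ∘ₗ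
        (LinearMap.proj j : (∀ k, W k) →ₗ[ℚ] W j).baseChange K := by
  refine LinearMap.ext fun x => ?_
  change (TensorProduct.piRight ℚ K K W).symm
      ((LinearEquiv.piCongrRight γ) (TensorProduct.piRight ℚ K K W x)) = _
  rw [piRight_symm_eq_sum, LinearMap.sum_apply]
  refine Finset.sum_congr rfl fun j _ => ?_
  rw [LinearEquiv.piCongrRight_apply, piRight_apply_eq_proj_baseChange]
  rfl

omit [Fintype ι] in
variable {K W} in
/-- `(pr_i)_K (in_j)_K = 0` for `i ≠ j`. [folklore] -/
private theorem proj_baseChange_comp_single_baseChange_of_ne {i j : ι} (h : i ≠ j) :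
    (LinearMap.proj i : (∀ k, W k) →ₗ[ℚ] W i).baseChange K ∘ₗ (LinearMap.single ℚ W j).baseChange K = 0 := by
  rw [← LinearMap.baseChange_comp, LinearMap.proj_comp_single_ne ℚ W i j h, LinearMap.baseChange_zero]

omit [Fintype ι] in
variable {K W} in
/-- `(pr_i)_K ((in_j)_K z) = 0` for `i ≠ j`. [folklore] -/
private theorem proj_baseChange_single_baseChange_of_ne {i j : ι} (h : i ≠ j) (z : K ⊗[ℚ] W j) :
    (LinearMap.proj i : (∀ k, W k) →ₗ[ℚ] W i).baseChange K ((LinearMap.single ℚ W j).baseChange K z) = 0 := by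
  rw [← LinearMap.comp_apply, proj_baseChange_comp_single_baseChange_of_ne h, LinearMap.zero_apply]

omit [Fintype ι] in
variable {K W} in
/-- `(pr_j)_K (in_j)_K = id`. [folklore] -/
private theorem proj_baseChange_comp_single_baseChange_same (j : ι) :
    (LinearMap.proj j : (∀ k, W k) →ₗ[ℚ] W j).baseChange K ∘ₗ (LinearMap.single ℚ W j).baseChange K =
      LinearMap.id := by
  rw [← LinearMap.baseChange_comp, LinearMap.proj_comp_single_same, LinearMap.baseChange_id]

omit [Fintype ι] in
variable {K W} in
/-- `(pr_j)_K ((in_j)_K z) = z`. [folklore] -/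
private theorem proj_baseChange_single_baseChange_same (j : ι) (z : K ⊗[ℚ] W j) :
    (LinearMap.proj j : (∀ k, W k) →ₗ[ℚ] W j).baseChange K ((LinearMap.single ℚ W j).baseChange K z) = z := by
  rw [← LinearMap.comp_apply, proj_baseChange_comp_single_baseChange_same, LinearMap.id_apply]

omit [DecidableEq ι] in
variable {W} in
/-- `Σ_j in_j ∘ pr_j = id` on `Π_j W_j`. [folklore] -/
private theorem sum_single_comp_proj [DecidableEq ι] :
    ∑ j, LinearMap.single ℚ W j ∘ₗ (LinearMap.proj j : (∀ k, W k) →ₗ[ℚ] W j) = LinearMap.id := by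
  refine LinearMap.ext fun x => ?_
  simp only [LinearMap.sum_apply, LinearMap.coe_comp, Function.comp_apply, LinearMap.coe_single,
    LinearMap.coe_proj, Function.eval, LinearMap.id_apply]
  exact Finset.univ_sum_single x

variable {K W} in
/-- `Σ_j (in_j)_K ∘ (pr_j)_K = id` on `K ⊗ Π_j W_j`. [folklore] -/
private theorem sum_single_baseChange_comp_proj_baseChange :
    ∑ j, (LinearMap.single ℚ W j).baseChange K ∘ₗ (LinearMap.proj j : (∀ k, W k) →ₗ[ℚ] W j).baseChange K =
      LinearMap.id := by
  rw [sum_baseChange_comp_baseChange, sum_single_comp_proj, LinearMap.baseChange_id]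

variable {K W} in
/-- **The blocks of `piBlockDiag γ`**: `piBlockDiag γ ∘ (in_j)_K = (in_j)_K ∘ γ_j`. [cite: Moonen2004MT, §4 Lemma 4.6] -/
theorem piBlockDiag_comp_single_baseChange (γ : ∀ j, (K ⊗[ℚ] W j) ≃ₗ[K] (K ⊗[ℚ] W j)) (j : ι) :
    (piBlockDiag K W γ : K ⊗[ℚ] (∀ j, W j) →ₗ[K] K ⊗[ℚ] (∀ j, W j)) ∘ₗ (LinearMap.single ℚ W j).baseChange K =
      (LinearMap.single ℚ W j).baseChange K ∘ₗ (γ j : K ⊗[ℚ] W j →ₗ[K] K ⊗[ℚ] W j) := by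
  refine LinearMap.ext fun z => ?_
  rw [LinearMap.comp_apply, coe_piBlockDiag, LinearMap.sum_apply, Finset.sum_eq_single j]
  · simp only [LinearMap.comp_apply, LinearEquiv.coe_coe, proj_baseChange_single_baseChange_same]
  · intro i _ hij
    simp only [LinearMap.comp_apply, proj_baseChange_single_baseChange_of_ne hij, map_zero]
  · exact fun h => absurd (Finset.mem_univ j) h

variable {K W} in
/-- `(pr_j)_K ∘ piBlockDiag γ = γ_j ∘ (pr_j)_K`. [cite: Moonen2004MT, §4 Lemma 4.6] -/
theorem proj_baseChange_comp_piBlockDiag (γ : ∀ j, (K ⊗[ℚ] W j) ≃ₗ[K] (K ⊗[ℚ] W j)) (j : ι) :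
    (LinearMap.proj j : (∀ k, W k) →ₗ[ℚ] W j).baseChange K ∘ₗ
        (piBlockDiag K W γ : K ⊗[ℚ] (∀ j, W j) →ₗ[K] K ⊗[ℚ] (∀ j, W j)) =
      (γ j : K ⊗[ℚ] W j →ₗ[K] K ⊗[ℚ] W j) ∘ₗ (LinearMap.proj j : (∀ k, W k) →ₗ[ℚ] W j).baseChange K := by
  refine LinearMap.ext fun x => ?_
  rw [LinearMap.comp_apply, coe_piBlockDiag, LinearMap.sum_apply, map_sum, Finset.sum_eq_single j]
  · simp only [LinearMap.comp_apply, LinearEquiv.coe_coe, proj_baseChange_single_baseChange_same]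
  · intro i _ hij
    simp only [LinearMap.comp_apply, LinearEquiv.coe_coe,
      proj_baseChange_single_baseChange_of_ne (Ne.symm hij)]
  · exact fun h => absurd (Finset.mem_univ j) h

variable {K W} in
/-- `piBlockDiag` is injective (its `j`-th block is `γ_j`). [cite: Moonen2004MT, §4 Lemma 4.6] -/
theorem piBlockDiag_injective : Function.Injective (piBlockDiag K W) := by
  intro γ γ' h
  funext j
  refine LinearEquiv.ext fun z => ?_
  have h₁ := LinearMap.congr_fun (proj_baseChange_comp_piBlockDiag γ j)
    ((LinearMap.single ℚ W j).baseChange K z)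
  have h₂ := LinearMap.congr_fun (proj_baseChange_comp_piBlockDiag γ' j)
    ((LinearMap.single ℚ W j).baseChange K z)
  rw [h] at h₁
  rw [h₁] at h₂
  simpa only [LinearMap.coe_comp, Function.comp_apply, LinearEquiv.coe_coe, ← LinearMap.comp_apply,
    proj_baseChange_comp_single_baseChange_same, LinearMap.id_apply] using h₂

end PiBlockDiag

section PiDiag

universe uK u

variable (K : Type uK) [Field K] [Algebra ℚ K] (V : Type u) [AddCommGroup V] [Module ℚ V]
  (ι : Type) [Fintype ι] [DecidableEq ι]

/-- **The diagonal embedding `Δ : GL(K ⊗ V) →* GL(K ⊗ (ι → V))`, `γ ↦ ⊕_j γ`** (the diagonal action of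
`MT(V)` on `V^{⊕ι}` of Moonen's Exercise 4.10 / (1.8), on `K`-points). [cite: Moonen2004MT, §4 Exercise 4.10]
[cite: Moonen1999MTNotes, (1.8)] -/
def piDiagEmbedding : ((K ⊗[ℚ] V) ≃ₗ[K] (K ⊗[ℚ] V)) →* ((K ⊗[ℚ] (ι → V)) ≃ₗ[K] (K ⊗[ℚ] (ι → V))) :=
  (piBlockDiag K fun _ : ι => V).comp (Pi.constMonoidHom ι _)

variable {K V ι} in
/-- `piDiagEmbedding K V ι γ = piBlockDiag (fun _ => γ)`. [cite: Moonen2004MT, §4 Exercise 4.10] -/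
@[simp]
theorem piDiagEmbedding_apply (γ : (K ⊗[ℚ] V) ≃ₗ[K] (K ⊗[ℚ] V)) :
    piDiagEmbedding K V ι γ = piBlockDiag K (fun _ : ι => V) fun _ => γ :=
  rfl

variable {K V ι} in
/-- **The diagonal automorphism as a linear map**: `Δ γ = Σ_j (in_j)_K γ (pr_j)_K`.
[cite: Moonen2004MT, §4 Exercise 4.10] -/
theorem coe_piDiagEmbedding (γ : (K ⊗[ℚ] V) ≃ₗ[K] (K ⊗[ℚ] V)) :
    (piDiagEmbedding K V ι γ : K ⊗[ℚ] (ι → V) →ₗ[K] K ⊗[ℚ] (ι → V)) =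
      ∑ j, (LinearMap.single ℚ (fun _ : ι => V) j).baseChange K ∘ₗ (γ : K ⊗[ℚ] V →ₗ[K] K ⊗[ℚ] V) ∘ₗ
        (LinearMap.proj j : (ι → V) →ₗ[ℚ] V).baseChange K :=
  coe_piBlockDiag (W := fun _ : ι => V) fun _ => γ

variable {K V ι} in
/-- `piDiagEmbedding` is injective for nonempty `ι`. [cite: Moonen2004MT, §4 Exercise 4.10] -/
theorem piDiagEmbedding_injective [Nonempty ι] : Function.Injective (piDiagEmbedding K V ι) := by
  intro γ γ' h
  obtain ⟨j⟩ := ‹Nonempty ι›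
  exact congr_fun (piBlockDiag_injective (W := fun _ : ι => V) h) j

end PiDiag

namespace HodgeStructure

/-! ### §2 Tensor powers of a family of morphisms; the family transport morphism -/

section Family

universe u v w

variable {R : Type u} [CommRing R] {Y : Type v} [AddCommGroup Y] [Module R Y] {ι : Type w} [Fintype ι]

/-- **Functoriality of Deligne's filtration for a FAMILY of filtered maps** (Hodge II, 1.1.12: `⊗` is a
functor of filtered objects, factor by factor): linear maps `g_i : Y → Y'` with `g_i (G q) ⊆ G' q` for all
`i, q` induce `⊗_i g_i : Fᵖ(⨂_ι Y) → Fᵖ(⨂_ι Y')`. The tree's `map_piTensorFiltration_le` is the constant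
family. [cite: DeligneHodgeII1971, 1.1.12] -/
theorem map_piTensorFiltration_le_family {Y' : Type*} [AddCommGroup Y'] [Module R Y']
    (G : ℤ → Submodule R Y) (G' : ℤ → Submodule R Y') (g : ι → (Y →ₗ[R] Y'))
    (hg : ∀ i q, (G q).map (g i) ≤ G' q) (p : ℤ) :
    (piTensorFiltration G ι p).map (PiTensorProduct.map g) ≤ piTensorFiltration G' ι p := by
  rw [piTensorFiltration_eq_span, Submodule.map_span, Submodule.span_le]
  rintro _ ⟨_, ⟨a, x, ha, hx, rfl⟩, rfl⟩
  rw [PiTensorProduct.map_tprod]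
  exact tprod_mem_piTensorFiltration G' a ha _ fun i => hg i _ ⟨x i, hx i, rfl⟩

end Family

section TensorPowerMapFamily

universe u v

variable {V : Type u} [AddCommGroup V] [Module ℚ V] {W : Type v} [AddCommGroup W] [Module ℚ W] {n : ℤ}

/-- `piTensorBaseChange` is natural in a family of linear maps:
`c ((⊗_i f_i) ⊗ ℂ) = (⊗_i (f_i ⊗ ℂ)) c`. Private plumbing. [folklore] -/
private theorem piTensorBaseChange_piMapFamily_baseChange {ι : Type} [Fintype ι] [DecidableEq ι]
    (f : ι → (V →ₗ[ℚ] W)) (x : ℂ ⊗[ℚ] (⨂[ℚ] _ : ι, V)) :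
    piTensorBaseChange W ι ((PiTensorProduct.map f).baseChange ℂ x) =
      PiTensorProduct.map (fun i ↦ (f i).baseChange ℂ) (piTensorBaseChange V ι x) := by
  induction x using TensorProduct.induction_on with
  | zero => simp
  | add x y hx hy => simp only [map_add, hx, hy]
  | tmul c z =>
    induction z using PiTensorProduct.induction_on with
    | smul_tprod r v =>
      simp [LinearMap.baseChange_tmul, piTensorBaseChange_tmul_tprod, TensorProduct.tmul_smul,
        PiTensorProduct.map_tprod, ofRat_apply, LinearMap.baseChange_tmul]
    | add x y hx hy => simp only [TensorProduct.tmul_add, map_add, hx, hy]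

/-- **`⊗` is a functor of filtered objects, for a family**: if each `(f_i)_ℂ` maps `Fᵖ H₁` into `Fᵖ H₂`
then `(⊗_i f_i)_ℂ` maps `Fᵖ(H₁^{⊗ k})` into `Fᵖ(H₂^{⊗ k})`. [cite: DeligneHodgeII1971, 1.1.12] -/
theorem map_tensorPowerFiltration_le_family (H₁ : HodgeStructure V n) (H₂ : HodgeStructure W n) {k : ℕ}
    (f : Fin k → (V →ₗ[ℚ] W)) (hf : ∀ i q, (H₁.F q).map ((f i).baseChange ℂ) ≤ H₂.F q) (p : ℤ) :
    (H₁.tensorPowerFiltration k p).map ((PiTensorProduct.map f).baseChange ℂ) ≤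
      H₂.tensorPowerFiltration k p := by
  classical
  rw [tensorPowerFiltration_eq_comap_piTensorFiltration,
    tensorPowerFiltration_eq_comap_piTensorFiltration, Submodule.map_le_iff_le_comap]
  intro Z hZ
  rw [Submodule.mem_comap] at hZ
  rw [Submodule.mem_comap, Submodule.mem_comap, piTensorBaseChange_piMapFamily_baseChange]
  exact map_piTensorFiltration_le_family H₁.F H₂.F (fun i => (f i).baseChange ℂ) hf p ⟨_, hZ, rfl⟩

variable [HodgeTensorFacts.{u, u}] [HodgeTensorFacts.{v, v}]

/-- **The tensor product `⊗_i f_i : H₁^{⊗ k} → H₂^{⊗ k}` of a FAMILY of morphisms of Hodge structures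
`f_i : H₁ → H₂` is a morphism** (underlying map Mathlib's `PiTensorProduct.map`; Deligne, Hodge II,
1.1.12). The tree's `Hom.tensorPowerMap f k` is the constant family. [cite: DeligneHodgeII1971, 1.1.12]
[cite: Moonen2017FamiliesMotives, §2.1 (p. 3)] -/
def Hom.tensorPowerMapFamily {H₁ : HodgeStructure V n} {H₂ : HodgeStructure W n} {k : ℕ}
    (f : Fin k → Hom H₁ H₂) : Hom (H₁.tensorPower k) (H₂.tensorPower k) where
  toLinearMap := PiTensorProduct.map fun i => (f i).toLinearMap
  map_F_le p := map_tensorPowerFiltration_le_family H₁ H₂ (fun i => (f i).toLinearMap)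
    (fun i => (f i).map_F_le) p

/-- The underlying map of `⊗_i f_i`. [cite: DeligneHodgeII1971, 1.1.12] -/
@[simp]
theorem Hom.tensorPowerMapFamily_toLinearMap {H₁ : HodgeStructure V n} {H₂ : HodgeStructure W n}
    {k : ℕ} (f : Fin k → Hom H₁ H₂) :
    (Hom.tensorPowerMapFamily f).toLinearMap = PiTensorProduct.map fun i => (f i).toLinearMap :=
  rfl

end TensorPowerMapFamily

section TransportFamily

universe u v

variable {V₁ : Type u} [AddCommGroup V₁] [Module ℚ V₁] [Module.Finite ℚ V₁]
  {V : Type u} [AddCommGroup V] [Module ℚ V] [Module.Finite ℚ V] [HodgeTensorFacts.{u, u}] {n : ℤ}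
  {H₁ : HodgeStructure V₁ n} {H : HodgeStructure V n}

/-- **The family transport morphism `T(f, g) = (⊗_i f_i) ⊗ (⊗_j g_jᵀ) : T^{a,b} H₁ → T^{a,b} H`** of families
of morphisms `f_i : H₁ → H`, `g_j : H → H₁` (tensor powers of families, transposes and tensor products of
morphisms are morphisms; re-typed on `T^{a,b}` by `Hom.congrF`). Underlying map
`tensorSpaceMapOverFamily (f_i) (g_j)` (`Hom.tensorSpaceMapFamily_toLinearMap`).
[cite: Deligne1982HodgeCycles, I §3.1] [cite: DeligneHodgeII1971, 1.1.12] -/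
def Hom.tensorSpaceMapFamily {a b : ℕ} (f : Fin a → Hom H₁ H) (g : Fin b → Hom H H₁) :
    Hom (H₁.tensorSpace a b) (H.tensorSpace a b) :=
  Hom.congrF (Hom.tensorMap (Hom.tensorPowerMapFamily f)
    (Hom.tensorPowerMapFamily fun j => (g j).dualMap)) (fun _ => rfl) (fun _ => rfl)

/-- The underlying map of the family transport morphism is `tensorSpaceMapOverFamily`.
[cite: Deligne1982HodgeCycles, I §3.1] -/
@[simp]
theorem Hom.tensorSpaceMapFamily_toLinearMap {a b : ℕ} (f : Fin a → Hom H₁ H) (g : Fin b → Hom H H₁) :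
    (Hom.tensorSpaceMapFamily f g).toLinearMap =
      tensorSpaceMapOverFamily (fun i => (f i).toLinearMap) (fun j => (g j).toLinearMap) :=
  rfl

/-- **`T(f, g)` carries Hodge tensors of `H₁` to Hodge tensors of `H` of the same type** (a morphism maps
Hodge classes to Hodge classes, the tree's `Hom.map_hodgeClasses_le`). [cite: Moonen2004MT, §4 Proposition 4.4]
[cite: Deligne1982HodgeCycles, I §3.1] -/
theorem tensorSpaceMapOverFamily_mem_hodgeClasses {a b : ℕ} (f : Fin a → Hom H₁ H)
    (g : Fin b → Hom H H₁) {p : ℤ} {t : hodgeTensorSpace V₁ a b}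
    (ht : t ∈ (H₁.tensorSpace a b).hodgeClasses p) :
    tensorSpaceMapOverFamily (fun i => (f i).toLinearMap) (fun j => (g j).toLinearMap) t ∈
      (H.tensorSpace a b).hodgeClasses p :=
  Hom.map_hodgeClasses_le (Hom.tensorSpaceMapFamily f g) p ⟨t, ht, rfl⟩

/-! ### §3 Block-scalar automorphisms with blocks in `MT(H)(K)` lie in `MT(H')(K)` -/

variable (K : Type v) [Field K] [Algebra ℚ K] {J : Type} [Fintype J]

/-- **Transfer to a sum of copies, on `K`-points.** Let `in_j : H₁ → H`, `pr_j : H → H₁` (`j ∈ J`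
finite) be morphisms of Hodge structures with `Σ_j in_j pr_j = id_V`; let `γ₁ ∈ MT(H₁)(K)` and let
`γ ∈ GL(K ⊗ V)` satisfy `(in_j)_K γ₁ = γ (in_j)_K` and `(pr_j)_K γ = γ₁ (pr_j)_K` for all `j`. Then
`γ ∈ MT(H)(K)`: every weight-`0` Hodge tensor `s` of `H` of type `(0,0)` has components `T(pr ε, in δ) s`
that are such tensors of `H₁`, fixed by `γ₁` after `ι_K`, and `ρ(γ)` is recovered from `ρ(γ₁)` on the
components (`tensorSpaceActOver_eq_self_of_forall_blocks`). This is the `K`-points content of Moonen's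
"`MT(Vⁿ) = MT(V)` […] through its diagonal action" (4.10) / (1.8). [cite: Moonen2004MT, §4 Exercise 4.10]
[cite: Moonen1999MTNotes, (1.8)] [cite: Deligne1982HodgeCycles, I Prop. 3.4] -/
theorem mem_mumfordTateGroupBaseChange_of_blocks (inj : J → Hom H₁ H) (pr : J → Hom H H₁)
    (hsum : ∑ j, (inj j).toLinearMap ∘ₗ (pr j).toLinearMap = LinearMap.id)
    {γ₁ : (K ⊗[ℚ] V₁) ≃ₗ[K] (K ⊗[ℚ] V₁)} (hγ₁ : γ₁ ∈ H₁.mumfordTateGroupBaseChange K)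
    {γ : (K ⊗[ℚ] V) ≃ₗ[K] (K ⊗[ℚ] V)}
    (hinj : ∀ j, (inj j).toLinearMap.baseChange K ∘ₗ (γ₁ : K ⊗[ℚ] V₁ →ₗ[K] K ⊗[ℚ] V₁) =
      (γ : K ⊗[ℚ] V →ₗ[K] K ⊗[ℚ] V) ∘ₗ (inj j).toLinearMap.baseChange K)
    (hpr : ∀ j, (pr j).toLinearMap.baseChange K ∘ₗ (γ : K ⊗[ℚ] V →ₗ[K] K ⊗[ℚ] V) =
      (γ₁ : K ⊗[ℚ] V₁ →ₗ[K] K ⊗[ℚ] V₁) ∘ₗ (pr j).toLinearMap.baseChange K) :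
    γ ∈ H.mumfordTateGroupBaseChange K := by
  rw [mem_mumfordTateGroupBaseChange_iff]
  intro a b hab s hs
  refine tensorSpaceActOver_eq_self_of_forall_blocks (fun j => (inj j).toLinearMap.baseChange K)
    (fun j => (pr j).toLinearMap.baseChange K) ?_ hinj hpr fun ε δ => ?_
  · rw [sum_baseChange_comp_baseChange, hsum, LinearMap.baseChange_id]
  · rw [← tensorSpaceToBaseChange_tensorSpaceMapOverFamily]
    exact (mem_mumfordTateGroupBaseChange_iff K H₁ γ₁).1 hγ₁ a b hab _
      (tensorSpaceMapOverFamily_mem_hodgeClasses (fun i => pr (ε i)) (fun j => inj (δ j)) hs)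

/-- **The Hodge-group twin, on `K`-points**: with the same block hypotheses and `γ₁ ∈ Hg(H₁)(K)`,
`γ ∈ Hg(H)(K)` (Hodge tensors of every type `(p,p)` are transported). [cite: Moonen1999MTNotes, (1.8) and (1.13)]
[cite: Moonen2004MT, §4 Exercise 4.10] -/
theorem mem_hodgeGroupBaseChange_of_blocks (inj : J → Hom H₁ H) (pr : J → Hom H H₁)
    (hsum : ∑ j, (inj j).toLinearMap ∘ₗ (pr j).toLinearMap = LinearMap.id)
    {γ₁ : (K ⊗[ℚ] V₁) ≃ₗ[K] (K ⊗[ℚ] V₁)} (hγ₁ : γ₁ ∈ H₁.hodgeGroupBaseChange K)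
    {γ : (K ⊗[ℚ] V) ≃ₗ[K] (K ⊗[ℚ] V)}
    (hinj : ∀ j, (inj j).toLinearMap.baseChange K ∘ₗ (γ₁ : K ⊗[ℚ] V₁ →ₗ[K] K ⊗[ℚ] V₁) =
      (γ : K ⊗[ℚ] V →ₗ[K] K ⊗[ℚ] V) ∘ₗ (inj j).toLinearMap.baseChange K)
    (hpr : ∀ j, (pr j).toLinearMap.baseChange K ∘ₗ (γ : K ⊗[ℚ] V →ₗ[K] K ⊗[ℚ] V) =
      (γ₁ : K ⊗[ℚ] V₁ →ₗ[K] K ⊗[ℚ] V₁) ∘ₗ (pr j).toLinearMap.baseChange K) :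
    γ ∈ H.hodgeGroupBaseChange K := by
  rw [mem_hodgeGroupBaseChange_iff]
  intro a b p hp s hs
  refine tensorSpaceActOver_eq_self_of_forall_blocks (fun j => (inj j).toLinearMap.baseChange K)
    (fun j => (pr j).toLinearMap.baseChange K) ?_ hinj hpr fun ε δ => ?_
  · rw [sum_baseChange_comp_baseChange, hsum, LinearMap.baseChange_id]
  · rw [← tensorSpaceToBaseChange_tensorSpaceMapOverFamily]
    exact (mem_hodgeGroupBaseChange_iff K H₁ γ₁).1 hγ₁ a b p hp _
      (tensorSpaceMapOverFamily_mem_hodgeClasses (fun i => pr (ε i)) (fun j => inj (δ j)) hs)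

/-- **Transfer to a sum of copies, on `ℚ`-points**: with morphisms `in_j`, `pr_j`, `Σ_j in_j pr_j = id`,
`g₁ ∈ MT(H₁)` and `g ∈ GL(V)` with `in_j g₁ = g in_j`, `pr_j g = g₁ pr_j`, one has `g ∈ MT(H)`.
[cite: Moonen2004MT, §4 Exercise 4.10] [cite: Moonen1999MTNotes, (1.8)] -/
theorem mem_mumfordTateGroup_of_blocks (inj : J → Hom H₁ H) (pr : J → Hom H H₁)
    (hsum : ∑ j, (inj j).toLinearMap ∘ₗ (pr j).toLinearMap = LinearMap.id)
    {g₁ : V₁ ≃ₗ[ℚ] V₁} (hg₁ : g₁ ∈ H₁.mumfordTateGroup) {g : V ≃ₗ[ℚ] V}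
    (hinj : ∀ j, (inj j).toLinearMap ∘ₗ (g₁ : V₁ →ₗ[ℚ] V₁) = (g : V →ₗ[ℚ] V) ∘ₗ (inj j).toLinearMap)
    (hpr : ∀ j, (pr j).toLinearMap ∘ₗ (g : V →ₗ[ℚ] V) = (g₁ : V₁ →ₗ[ℚ] V₁) ∘ₗ (pr j).toLinearMap) :
    g ∈ H.mumfordTateGroup := by
  rw [mem_mumfordTateGroup_iff]
  intro a b hab s hs
  rw [← tensorSpaceActOver_rat]
  refine tensorSpaceActOver_eq_self_of_forall_blocks (fun j => (inj j).toLinearMap)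
    (fun j => (pr j).toLinearMap) hsum hinj hpr fun ε δ => ?_
  rw [tensorSpaceActOver_rat]
  exact (mem_mumfordTateGroup_iff H₁ g₁).1 hg₁ a b hab _
    (tensorSpaceMapOverFamily_mem_hodgeClasses (fun i => pr (ε i)) (fun j => inj (δ j)) hs)

/-- **The Hodge-group twin, on `ℚ`-points.** [cite: Moonen1999MTNotes, (1.8) and (1.13)] -/
theorem mem_hodgeGroup_of_blocks (inj : J → Hom H₁ H) (pr : J → Hom H H₁)
    (hsum : ∑ j, (inj j).toLinearMap ∘ₗ (pr j).toLinearMap = LinearMap.id)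
    {g₁ : V₁ ≃ₗ[ℚ] V₁} (hg₁ : g₁ ∈ H₁.hodgeGroup) {g : V ≃ₗ[ℚ] V}
    (hinj : ∀ j, (inj j).toLinearMap ∘ₗ (g₁ : V₁ →ₗ[ℚ] V₁) = (g : V →ₗ[ℚ] V) ∘ₗ (inj j).toLinearMap)
    (hpr : ∀ j, (pr j).toLinearMap ∘ₗ (g : V →ₗ[ℚ] V) = (g₁ : V₁ →ₗ[ℚ] V₁) ∘ₗ (pr j).toLinearMap) :
    g ∈ H.hodgeGroup := by
  rw [mem_hodgeGroup_iff]
  intro a b p hp s hs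
  rw [← tensorSpaceActOver_rat]
  refine tensorSpaceActOver_eq_self_of_forall_blocks (fun j => (inj j).toLinearMap)
    (fun j => (pr j).toLinearMap) hsum hinj hpr fun ε δ => ?_
  rw [tensorSpaceActOver_rat]
  exact (mem_hodgeGroup_iff H₁ g₁).1 hg₁ a b p hp _
    (tensorSpaceMapOverFamily_mem_hodgeClasses (fun i => pr (ε i)) (fun j => inj (δ j)) hs)

end TransportFamily

/-! ### §4 The diagonal of `H ⊕ H`: `Δ MT(H)(K) ⊆ MT(H ⊕ H)(K)`, hence `MT(H ⊕ H)(K) = Δ MT(H)(K)` -/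

section Diagonal

universe u v

variable {V : Type u} [AddCommGroup V] [Module ℚ V] [Module.Finite ℚ V] [HodgeTensorFacts.{u, u}]
  {n : ℤ} {H : HodgeStructure V n} (K : Type v) [Field K] [Algebra ℚ K]

/-- The two inclusions `inl, inr : H → H ⊕ H`, indexed by `Bool` (`true ↦ inl`). [cite: DeligneHodgeII1971, 2.1] -/
def Hom.prodSelfIn (H : HodgeStructure V n) (c : Bool) : Hom H (H.prod H) :=
  bif c then Hom.prodInl H H else Hom.prodInr H H

/-- The two projections `fst, snd : H ⊕ H → H`, indexed by `Bool` (`true ↦ fst`). [cite: DeligneHodgeII1971, 2.1] -/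
def Hom.prodSelfPr (H : HodgeStructure V n) (c : Bool) : Hom (H.prod H) H :=
  bif c then Hom.prodFst H H else Hom.prodSnd H H

omit [Module.Finite ℚ V] [HodgeTensorFacts.{u, u}] in
/-- `in_true = inl`. [cite: DeligneHodgeII1971, 2.1] -/
@[simp]
theorem Hom.prodSelfIn_true_toLinearMap : (Hom.prodSelfIn H true).toLinearMap = LinearMap.inl ℚ V V := rfl

omit [Module.Finite ℚ V] [HodgeTensorFacts.{u, u}] in
/-- `in_false = inr`. [cite: DeligneHodgeII1971, 2.1] -/
@[simp]
theorem Hom.prodSelfIn_false_toLinearMap : (Hom.prodSelfIn H false).toLinearMap = LinearMap.inr ℚ V V :=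
  rfl

omit [Module.Finite ℚ V] [HodgeTensorFacts.{u, u}] in
/-- `pr_true = fst`. [cite: DeligneHodgeII1971, 2.1] -/
@[simp]
theorem Hom.prodSelfPr_true_toLinearMap : (Hom.prodSelfPr H true).toLinearMap = LinearMap.fst ℚ V V := rfl

omit [Module.Finite ℚ V] [HodgeTensorFacts.{u, u}] in
/-- `pr_false = snd`. [cite: DeligneHodgeII1971, 2.1] -/
@[simp]
theorem Hom.prodSelfPr_false_toLinearMap : (Hom.prodSelfPr H false).toLinearMap = LinearMap.snd ℚ V V :=
  rfl

omit [Module.Finite ℚ V] [HodgeTensorFacts.{u, u}] in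
/-- `inl fst + inr snd = id` on `V × V`, in the `Bool`-indexed form. [cite: DeligneHodgeII1971, 2.1] -/
theorem sum_prodSelfIn_comp_prodSelfPr :
    ∑ c, (Hom.prodSelfIn H c).toLinearMap ∘ₗ (Hom.prodSelfPr H c).toLinearMap = LinearMap.id := by
  rw [Fintype.sum_bool, Hom.prodSelfIn_true_toLinearMap, Hom.prodSelfPr_true_toLinearMap,
    Hom.prodSelfIn_false_toLinearMap, Hom.prodSelfPr_false_toLinearMap]
  ext <;> simp

omit [Module.Finite ℚ V] [HodgeTensorFacts.{u, u}] in
/-- `fst_K (inl_K x) = x`. Private plumbing. [folklore] -/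
private theorem fst_baseChange_inl_baseChange (x : K ⊗[ℚ] V) :
    (LinearMap.fst ℚ V V).baseChange K ((LinearMap.inl ℚ V V).baseChange K x) = x := by
  rw [← LinearMap.comp_apply, ← LinearMap.baseChange_comp, LinearMap.fst_comp_inl, LinearMap.baseChange_id,
    LinearMap.id_apply]

omit [Module.Finite ℚ V] [HodgeTensorFacts.{u, u}] in
/-- `snd_K (inl_K x) = 0`. Private plumbing. [folklore] -/
private theorem snd_baseChange_inl_baseChange (x : K ⊗[ℚ] V) :
    (LinearMap.snd ℚ V V).baseChange K ((LinearMap.inl ℚ V V).baseChange K x) = 0 := by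
  rw [← LinearMap.comp_apply, ← LinearMap.baseChange_comp, LinearMap.snd_comp_inl, LinearMap.baseChange_zero,
    LinearMap.zero_apply]

omit [Module.Finite ℚ V] [HodgeTensorFacts.{u, u}] in
/-- `fst_K (inr_K x) = 0`. Private plumbing. [folklore] -/
private theorem fst_baseChange_inr_baseChange (x : K ⊗[ℚ] V) :
    (LinearMap.fst ℚ V V).baseChange K ((LinearMap.inr ℚ V V).baseChange K x) = 0 := by
  rw [← LinearMap.comp_apply, ← LinearMap.baseChange_comp, LinearMap.fst_comp_inr, LinearMap.baseChange_zero,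
    LinearMap.zero_apply]

omit [Module.Finite ℚ V] [HodgeTensorFacts.{u, u}] in
/-- `snd_K (inr_K x) = x`. Private plumbing. [folklore] -/
private theorem snd_baseChange_inr_baseChange (x : K ⊗[ℚ] V) :
    (LinearMap.snd ℚ V V).baseChange K ((LinearMap.inr ℚ V V).baseChange K x) = x := by
  rw [← LinearMap.comp_apply, ← LinearMap.baseChange_comp, LinearMap.snd_comp_inr, LinearMap.baseChange_id,
    LinearMap.id_apply]

/-- **`γ ⊕ γ ∈ MT(H ⊕ H)(K)` for `γ ∈ MT(H)(K)`** — the reverse inclusion of Moonen's (4.10) for `n = 2`,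
on `K`-points, for every field `K ⊇ ℚ`. [cite: Moonen2004MT, §4 Exercise 4.10] [cite: Moonen1999MTNotes, (1.8)] -/
theorem diagEmbedding_mem_mumfordTateGroupBaseChange {γ : (K ⊗[ℚ] V) ≃ₗ[K] (K ⊗[ℚ] V)}
    (hγ : γ ∈ H.mumfordTateGroupBaseChange K) :
    diagEmbedding K V γ ∈ (H.prod H).mumfordTateGroupBaseChange K := by
  refine mem_mumfordTateGroupBaseChange_of_blocks K (Hom.prodSelfIn H) (Hom.prodSelfPr H)
    sum_prodSelfIn_comp_prodSelfPr hγ (fun c => ?_) (fun c => ?_)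
  · rw [diagEmbedding_apply, coe_blockDiag]
    refine LinearMap.ext fun x => ?_
    cases c <;> simp [fst_baseChange_inl_baseChange, snd_baseChange_inl_baseChange,
      fst_baseChange_inr_baseChange, snd_baseChange_inr_baseChange]
  · rw [diagEmbedding_apply, coe_blockDiag]
    refine LinearMap.ext fun x => ?_
    cases c <;> simp [fst_baseChange_inl_baseChange, snd_baseChange_inl_baseChange,
      fst_baseChange_inr_baseChange, snd_baseChange_inr_baseChange]

/-- **The Hodge-group twin: `γ ⊕ γ ∈ Hg(H ⊕ H)(K)` for `γ ∈ Hg(H)(K)`.** [cite: Moonen1999MTNotes, (1.13)] -/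
theorem diagEmbedding_mem_hodgeGroupBaseChange {γ : (K ⊗[ℚ] V) ≃ₗ[K] (K ⊗[ℚ] V)}
    (hγ : γ ∈ H.hodgeGroupBaseChange K) :
    diagEmbedding K V γ ∈ (H.prod H).hodgeGroupBaseChange K := by
  refine mem_hodgeGroupBaseChange_of_blocks K (Hom.prodSelfIn H) (Hom.prodSelfPr H)
    sum_prodSelfIn_comp_prodSelfPr hγ (fun c => ?_) (fun c => ?_)
  · rw [diagEmbedding_apply, coe_blockDiag]
    refine LinearMap.ext fun x => ?_
    cases c <;> simp [fst_baseChange_inl_baseChange, snd_baseChange_inl_baseChange,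
      fst_baseChange_inr_baseChange, snd_baseChange_inr_baseChange]
  · rw [diagEmbedding_apply, coe_blockDiag]
    refine LinearMap.ext fun x => ?_
    cases c <;> simp [fst_baseChange_inl_baseChange, snd_baseChange_inl_baseChange,
      fst_baseChange_inr_baseChange, snd_baseChange_inr_baseChange]

/-- `Δ MT(H)(K) ⊆ MT(H ⊕ H)(K)`. [cite: Moonen2004MT, §4 Exercise 4.10] -/
theorem map_diagEmbedding_mumfordTateGroupBaseChange_le :
    (H.mumfordTateGroupBaseChange K).map (diagEmbedding K V) ≤ (H.prod H).mumfordTateGroupBaseChange K := by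
  rintro _ ⟨γ, hγ, rfl⟩
  exact diagEmbedding_mem_mumfordTateGroupBaseChange K hγ

/-- `Δ Hg(H)(K) ⊆ Hg(H ⊕ H)(K)`. [cite: Moonen1999MTNotes, (1.13)] -/
theorem map_diagEmbedding_hodgeGroupBaseChange_le :
    (H.hodgeGroupBaseChange K).map (diagEmbedding K V) ≤ (H.prod H).hodgeGroupBaseChange K := by
  rintro _ ⟨γ, hγ, rfl⟩
  exact diagEmbedding_mem_hodgeGroupBaseChange K hγ

/-- **Moonen's Exercise 4.10 (`n = 2`), on `K`-points, as an equality: `MT(H ⊕ H)(K) = Δ MT(H)(K)`**, for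
every field `K ⊇ ℚ` (with row g9-#1's `mumfordTateGroupBaseChange_prod_self_le`).
[cite: Moonen2004MT, §4 Exercise 4.10] [cite: Moonen1999MTNotes, (1.8)] -/
theorem mumfordTateGroupBaseChange_prod_self_eq :
    (H.prod H).mumfordTateGroupBaseChange K = (H.mumfordTateGroupBaseChange K).map (diagEmbedding K V) :=
  le_antisymm mumfordTateGroupBaseChange_prod_self_le (map_diagEmbedding_mumfordTateGroupBaseChange_le K)

/-- **Moonen 1999 (1.13) "if `V₁ = V₂` then `Hg(V)` is the diagonal subgroup of `Hg(V₁) × Hg(V₂)`", on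
`K`-points, as an equality: `Hg(H ⊕ H)(K) = Δ Hg(H)(K)`.** [cite: Moonen1999MTNotes, (1.13)]
[cite: Moonen2004MT, §4 Exercise 4.10] -/
theorem hodgeGroupBaseChange_prod_self_eq :
    (H.prod H).hodgeGroupBaseChange K = (H.hodgeGroupBaseChange K).map (diagEmbedding K V) :=
  le_antisymm hodgeGroupBaseChange_prod_self_le (map_diagEmbedding_hodgeGroupBaseChange_le K)

/-- **`γ' ∈ MT(H ⊕ H)(K)` iff `γ' = γ ⊕ γ` for some `γ ∈ MT(H)(K)`.** [cite: Moonen2004MT, §4 Exercise 4.10] -/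
theorem mem_mumfordTateGroupBaseChange_prod_self_iff {γ' : (K ⊗[ℚ] (V × V)) ≃ₗ[K] (K ⊗[ℚ] (V × V))} :
    γ' ∈ (H.prod H).mumfordTateGroupBaseChange K ↔
      ∃ γ ∈ H.mumfordTateGroupBaseChange K, diagEmbedding K V γ = γ' := by
  rw [mumfordTateGroupBaseChange_prod_self_eq, Subgroup.mem_map]

/-- **`γ' ∈ Hg(H ⊕ H)(K)` iff `γ' = γ ⊕ γ` for some `γ ∈ Hg(H)(K)`.** [cite: Moonen1999MTNotes, (1.13)] -/
theorem mem_hodgeGroupBaseChange_prod_self_iff {γ' : (K ⊗[ℚ] (V × V)) ≃ₗ[K] (K ⊗[ℚ] (V × V))} :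
    γ' ∈ (H.prod H).hodgeGroupBaseChange K ↔
      ∃ γ ∈ H.hodgeGroupBaseChange K, diagEmbedding K V γ = γ' := by
  rw [hodgeGroupBaseChange_prod_self_eq, Subgroup.mem_map]

end Diagonal

/-! ### §5 Finite direct sums: `MT(⊕_j H_j)(K) ≤ (Π_j MT(H_j)(K))` and `MT(H^{⊕ι})(K) = Δ MT(H)(K)` -/

section Pi

universe u v

variable {ι : Type} [Fintype ι] [DecidableEq ι] {W : ι → Type u} [∀ j, AddCommGroup (W j)]
  [∀ j, Module ℚ (W j)] [∀ j, Module.Finite ℚ (W j)] [HodgeTensorFacts.{u, u}] {n : ℤ}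
  {H : ∀ j, HodgeStructure (W j) n} {K : Type v} [Field K] [Algebra ℚ K]

/-- **Moonen's Lemma 4.6 for finitely many summands, on `K`-points:
`MT(⊕_j H_j)(K) ⊆ Π_j MT(H_j)(K)`** through the block-diagonal embedding `piBlockDiag` (row g9-#1's
`eq_sum_blocks_of_mem_mumfordTateGroupBaseChange_pi`, restated as an inclusion of subgroups). The equality
fails in general (no claim). [cite: Moonen2004MT, §4 Lemma 4.6] -/
theorem mumfordTateGroupBaseChange_pi_le :
    (pi H).mumfordTateGroupBaseChange K ≤
      (Subgroup.pi Set.univ fun j => (H j).mumfordTateGroupBaseChange K).map (piBlockDiag K W) := by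
  intro γ hγ
  refine ⟨fun j => restrictBaseChange K (Hom.piSingle H j) (Hom.piProj H j) (piProj_piSingle_apply H j) hγ,
    fun j _ => restrictBaseChange_piSingle_mem_mumfordTateGroupBaseChange hγ j, ?_⟩
  refine LinearEquiv.toLinearMap_injective ?_
  rw [coe_piBlockDiag, eq_sum_blocks_of_mem_mumfordTateGroupBaseChange_pi hγ]

/-- **Moonen 1999 (1.13) for finitely many summands, on `K`-points: `Hg(⊕_j H_j)(K) ⊆ Π_j Hg(H_j)(K)`.**
[cite: Moonen1999MTNotes, (1.13)] -/
theorem hodgeGroupBaseChange_pi_le :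
    (pi H).hodgeGroupBaseChange K ≤
      (Subgroup.pi Set.univ fun j => (H j).hodgeGroupBaseChange K).map (piBlockDiag K W) := by
  intro γ hγ
  have hγ' := hodgeGroupBaseChange_le_mumfordTateGroupBaseChange K _ hγ
  refine ⟨fun j => restrictBaseChange K (Hom.piSingle H j) (Hom.piProj H j) (piProj_piSingle_apply H j) hγ',
    fun j _ => restrictBaseChange_piSingle_mem_hodgeGroupBaseChange hγ j, ?_⟩
  refine LinearEquiv.toLinearMap_injective ?_
  rw [coe_piBlockDiag, eq_sum_blocks_of_mem_mumfordTateGroupBaseChange_pi hγ']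

end Pi

section PiConst

universe u v

variable {ι : Type} [Fintype ι] [DecidableEq ι] {V : Type u} [AddCommGroup V] [Module ℚ V]
  [Module.Finite ℚ V] [HodgeTensorFacts.{u, u}] {n : ℤ} {H : HodgeStructure V n}
  (K : Type v) [Field K] [Algebra ℚ K]

omit [Module.Finite ℚ V] [HodgeTensorFacts.{u, u}] in
/-- `Σ_j in_j pr_j = id` on `V^{⊕ι}`, for the morphisms `Hom.piSingle`, `Hom.piProj`. [cite: DeligneHodgeII1971, 2.1] -/
theorem sum_piSingle_comp_piProj :
    ∑ j, (Hom.piSingle (fun _ : ι => H) j).toLinearMap ∘ₗ (Hom.piProj (fun _ : ι => H) j).toLinearMap =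
      LinearMap.id := by
  simp only [Hom.piSingle_toLinearMap, Hom.piProj_toLinearMap]
  exact sum_single_comp_proj

/-- **`Δ γ ∈ MT(H^{⊕ι})(K)` for `γ ∈ MT(H)(K)`** — the reverse inclusion of Moonen's (4.10) / (1.8)
"`MT(V^{⊕n})` is isomorphic to `MT(V)` acting diagonally", on `K`-points, for every field `K ⊇ ℚ`.
[cite: Moonen2004MT, §4 Exercise 4.10] [cite: Moonen1999MTNotes, (1.8)] -/
theorem piDiagEmbedding_mem_mumfordTateGroupBaseChange {γ : (K ⊗[ℚ] V) ≃ₗ[K] (K ⊗[ℚ] V)}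
    (hγ : γ ∈ H.mumfordTateGroupBaseChange K) :
    piDiagEmbedding K V ι γ ∈ (pi fun _ : ι => H).mumfordTateGroupBaseChange K := by
  refine mem_mumfordTateGroupBaseChange_of_blocks K (Hom.piSingle fun _ : ι => H)
    (Hom.piProj fun _ : ι => H) sum_piSingle_comp_piProj hγ (fun j => ?_) (fun j => ?_)
  · rw [Hom.piSingle_toLinearMap, piDiagEmbedding_apply, piBlockDiag_comp_single_baseChange]
  · rw [Hom.piProj_toLinearMap, piDiagEmbedding_apply, proj_baseChange_comp_piBlockDiag]

/-- **The Hodge-group twin: `Δ γ ∈ Hg(H^{⊕ι})(K)` for `γ ∈ Hg(H)(K)`.** [cite: Moonen1999MTNotes, (1.13)] -/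
theorem piDiagEmbedding_mem_hodgeGroupBaseChange {γ : (K ⊗[ℚ] V) ≃ₗ[K] (K ⊗[ℚ] V)}
    (hγ : γ ∈ H.hodgeGroupBaseChange K) :
    piDiagEmbedding K V ι γ ∈ (pi fun _ : ι => H).hodgeGroupBaseChange K := by
  refine mem_hodgeGroupBaseChange_of_blocks K (Hom.piSingle fun _ : ι => H)
    (Hom.piProj fun _ : ι => H) sum_piSingle_comp_piProj hγ (fun j => ?_) (fun j => ?_)
  · rw [Hom.piSingle_toLinearMap, piDiagEmbedding_apply, piBlockDiag_comp_single_baseChange]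
  · rw [Hom.piProj_toLinearMap, piDiagEmbedding_apply, proj_baseChange_comp_piBlockDiag]

/-- `MT(H^{⊕ι})(K) ⊆ Δ MT(H)(K)` for nonempty `ι` (row g9-#1's
`eq_sum_diag_of_mem_mumfordTateGroupBaseChange_pi_const`, restated through `piDiagEmbedding`).
[cite: Moonen2004MT, §4 Exercise 4.10] -/
theorem mumfordTateGroupBaseChange_pi_const_le [Nonempty ι] :
    (pi fun _ : ι => H).mumfordTateGroupBaseChange K ≤
      (H.mumfordTateGroupBaseChange K).map (piDiagEmbedding K V ι) := by
  intro γ hγ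
  obtain ⟨j₀⟩ := ‹Nonempty ι›
  refine ⟨restrictBaseChange K (Hom.piSingle (fun _ : ι => H) j₀) (Hom.piProj (fun _ : ι => H) j₀)
      (piProj_piSingle_apply (fun _ : ι => H) j₀) hγ,
    restrictBaseChange_piSingle_mem_mumfordTateGroupBaseChange hγ j₀, ?_⟩
  refine LinearEquiv.toLinearMap_injective ?_
  rw [coe_piDiagEmbedding, eq_sum_diag_of_mem_mumfordTateGroupBaseChange_pi_const hγ j₀]

/-- `Hg(H^{⊕ι})(K) ⊆ Δ Hg(H)(K)` for nonempty `ι`. [cite: Moonen1999MTNotes, (1.13)] -/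
theorem hodgeGroupBaseChange_pi_const_le [Nonempty ι] :
    (pi fun _ : ι => H).hodgeGroupBaseChange K ≤ (H.hodgeGroupBaseChange K).map (piDiagEmbedding K V ι) := by
  intro γ hγ
  obtain ⟨j₀⟩ := ‹Nonempty ι›
  have hγ' := hodgeGroupBaseChange_le_mumfordTateGroupBaseChange K _ hγ
  refine ⟨restrictBaseChange K (Hom.piSingle (fun _ : ι => H) j₀) (Hom.piProj (fun _ : ι => H) j₀)
      (piProj_piSingle_apply (fun _ : ι => H) j₀) hγ',
    restrictBaseChange_piSingle_mem_hodgeGroupBaseChange hγ j₀, ?_⟩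
  refine LinearEquiv.toLinearMap_injective ?_
  rw [coe_piDiagEmbedding, eq_sum_diag_of_mem_mumfordTateGroupBaseChange_pi_const hγ' j₀]

/-- **Moonen's Exercise 4.10 / (1.8), on `K`-points, as an equality: `MT(H^{⊕ι})(K) = Δ MT(H)(K)`** for
`ι` finite nonempty ("`n ≥ 1`") and every field `K ⊇ ℚ`. [cite: Moonen2004MT, §4 Exercise 4.10]
[cite: Moonen1999MTNotes, (1.8)] -/
theorem mumfordTateGroupBaseChange_pi_const_eq [Nonempty ι] :
    (pi fun _ : ι => H).mumfordTateGroupBaseChange K =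
      (H.mumfordTateGroupBaseChange K).map (piDiagEmbedding K V ι) := by
  refine le_antisymm (mumfordTateGroupBaseChange_pi_const_le K) ?_
  rintro _ ⟨γ, hγ, rfl⟩
  exact piDiagEmbedding_mem_mumfordTateGroupBaseChange K hγ

/-- **`Hg(H^{⊕ι})(K) = Δ Hg(H)(K)`** for `ι` finite nonempty. [cite: Moonen1999MTNotes, (1.8) and (1.13)] -/
theorem hodgeGroupBaseChange_pi_const_eq [Nonempty ι] :
    (pi fun _ : ι => H).hodgeGroupBaseChange K = (H.hodgeGroupBaseChange K).map (piDiagEmbedding K V ι) := by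
  refine le_antisymm (hodgeGroupBaseChange_pi_const_le K) ?_
  rintro _ ⟨γ, hγ, rfl⟩
  exact piDiagEmbedding_mem_hodgeGroupBaseChange K hγ

end PiConst

/-! ### §6 `ℚ`-points: `g ⊕ g ∈ MT(H ⊕ H) ↔ g ∈ MT(H)` -/

section RatPoints

universe u

variable {V : Type u} [AddCommGroup V] [Module ℚ V] [Module.Finite ℚ V] [HodgeTensorFacts.{u, u}]
  {n : ℤ} {H : HodgeStructure V n}

/-- **`g ⊕ g ∈ MT(H ⊕ H)` for `g ∈ MT(H)` (`ℚ`-points).** [cite: Moonen2004MT, §4 Exercise 4.10]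
[cite: Moonen1999MTNotes, (1.8)] -/
theorem prodCongr_mem_mumfordTateGroup {g : V ≃ₗ[ℚ] V} (hg : g ∈ H.mumfordTateGroup) :
    g.prodCongr g ∈ (H.prod H).mumfordTateGroup := by
  refine mem_mumfordTateGroup_of_blocks (Hom.prodSelfIn H) (Hom.prodSelfPr H) sum_prodSelfIn_comp_prodSelfPr
    hg (fun c => ?_) (fun c => ?_)
  · cases c <;> (refine LinearMap.ext fun x => ?_) <;> simp
  · cases c <;> (refine LinearMap.ext fun x => ?_) <;> simp

/-- **`g ⊕ g ∈ Hg(H ⊕ H)` for `g ∈ Hg(H)` (`ℚ`-points).** [cite: Moonen1999MTNotes, (1.13)] -/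
theorem prodCongr_mem_hodgeGroup {g : V ≃ₗ[ℚ] V} (hg : g ∈ H.hodgeGroup) :
    g.prodCongr g ∈ (H.prod H).hodgeGroup := by
  refine mem_hodgeGroup_of_blocks (Hom.prodSelfIn H) (Hom.prodSelfPr H) sum_prodSelfIn_comp_prodSelfPr
    hg (fun c => ?_) (fun c => ?_)
  · cases c <;> (refine LinearMap.ext fun x => ?_) <;> simp
  · cases c <;> (refine LinearMap.ext fun x => ?_) <;> simp

omit [Module.Finite ℚ V] [HodgeTensorFacts.{u, u}] in
/-- The restriction `fst ∘ (g ⊕ g) ∘ inl` of a diagonal automorphism is `g`. Private plumbing. [folklore] -/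
private theorem restrictRetract_prodCongr (g : V ≃ₗ[ℚ] V)
    (h : ∀ x, (Hom.prodInl H H).toLinearMap ((Hom.prodFst H H).toLinearMap ((g.prodCongr g) x)) =
      (g.prodCongr g) ((Hom.prodInl H H).toLinearMap ((Hom.prodFst H H).toLinearMap x))) :
    restrictRetract (Hom.prodInl H H).toLinearMap (Hom.prodFst H H).toLinearMap (prodFst_prodInl_apply H H)
      (g.prodCongr g) h = g :=
  LinearEquiv.ext fun _ => rfl

/-- **`ℚ`-points of Moonen's (4.10) for `n = 2`: `g ⊕ g ∈ MT(H ⊕ H) ↔ g ∈ MT(H)`** (⇐ above; ⇒ row g9-#1's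
`restrictRetract_mem_mumfordTateGroup` for the summand `(inl, fst)`). [cite: Moonen2004MT, §4 Exercise 4.10] -/
theorem prodCongr_mem_mumfordTateGroup_iff {g : V ≃ₗ[ℚ] V} :
    g.prodCongr g ∈ (H.prod H).mumfordTateGroup ↔ g ∈ H.mumfordTateGroup := by
  refine ⟨fun hg => ?_, prodCongr_mem_mumfordTateGroup⟩
  have h := restrictRetract_mem_mumfordTateGroup (Hom.prodInl H H) (Hom.prodFst H H) (prodFst_prodInl_apply H H) hg
  rwa [restrictRetract_prodCongr] at h

/-- **`g ⊕ g ∈ Hg(H ⊕ H) ↔ g ∈ Hg(H)` (`ℚ`-points).** [cite: Moonen1999MTNotes, (1.13)] -/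
theorem prodCongr_mem_hodgeGroup_iff {g : V ≃ₗ[ℚ] V} :
    g.prodCongr g ∈ (H.prod H).hodgeGroup ↔ g ∈ H.hodgeGroup := by
  refine ⟨fun hg => ?_, prodCongr_mem_hodgeGroup⟩
  have h := restrictRetract_mem_hodgeGroup (Hom.prodInl H H) (Hom.prodFst H H) (prodFst_prodInl_apply H H) hg
  rwa [restrictRetract_prodCongr] at h

/-- **`MT(H ⊕ H)(ℚ) = Δ MT(H)(ℚ)`: `g' ∈ MT(H ⊕ H)` iff `g' = g ⊕ g` for some `g ∈ MT(H)`** (every element of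
`MT(H ⊕ H)` is diagonal: it commutes with the Hodge endomorphisms `inl fst`, `inr snd`, `inl snd`, `inr fst`
of `H ⊕ H`, the tree's `endAlg.comp_eq_comp_of_mem_mumfordTateGroup`). [cite: Moonen2004MT, §4 Exercise 4.10]
[cite: Moonen1999MTNotes, (1.8)] -/
theorem mem_mumfordTateGroup_prod_self_iff {g' : (V × V) ≃ₗ[ℚ] (V × V)} :
    g' ∈ (H.prod H).mumfordTateGroup ↔ ∃ g ∈ H.mumfordTateGroup, g' = g.prodCongr g := by
  constructor
  · intro hg'
    -- `g'` commutes with the four elementary Hodge endomorphisms of `H ⊕ H`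
    have hc : ∀ (φ : Hom (H.prod H) (H.prod H)) (x : V × V),
        φ.toLinearMap (g' x) = g' (φ.toLinearMap x) := fun φ x => by
      have h := LinearMap.congr_fun (endAlg.comp_eq_comp_of_mem_mumfordTateGroup (H.prod H) hg'
        ⟨φ.toLinearMap, Hom.toLinearMap_mem_endAlg φ⟩) x
      simpa only [LinearMap.coe_comp, Function.comp_apply, LinearEquiv.coe_coe] using h
    have h₁₁ := hc ((Hom.prodInl H H).comp (Hom.prodFst H H))
    have h₂₂ := hc ((Hom.prodInr H H).comp (Hom.prodSnd H H))
    have h₁₂ := hc ((Hom.prodInl H H).comp (Hom.prodSnd H H))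
    refine ⟨restrictRetract (Hom.prodInl H H).toLinearMap (Hom.prodFst H H).toLinearMap
      (prodFst_prodInl_apply H H) g' h₁₁, restrictRetract_mem_mumfordTateGroup (Hom.prodInl H H)
      (Hom.prodFst H H) (prodFst_prodInl_apply H H) hg', LinearEquiv.ext fun x => ?_⟩
    obtain ⟨v, w⟩ := x
    have e₁ : ∀ y : V × V, ((g' y).1, (0 : V)) = g' (y.1, 0) := fun y => by
      simpa [Hom.comp] using h₁₁ y
    have e₂ : ∀ y : V × V, ((0 : V), (g' y).2) = g' (0, y.2) := fun y => by
      simpa [Hom.comp] using h₂₂ y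
    have e₃ : ∀ y : V × V, ((g' y).2, (0 : V)) = g' (y.2, 0) := fun y => by
      simpa [Hom.comp] using h₁₂ y
    have hv : g' (v, 0) = ((g' (v, 0)).1, 0) := (e₁ (v, 0)).symm
    have hw₂ : (g' (0, w)).2 = (g' (w, 0)).1 := by
      simpa using congrArg Prod.fst (e₃ (0, w))
    have hw : g' (0, w) = (0, (g' (w, 0)).1) := by
      rw [← hw₂]
      exact (e₂ (0, w)).symm
    have hsplit : g' (v, w) = g' (v, 0) + g' (0, w) := by
      rw [← map_add, Prod.mk_add_mk, add_zero, zero_add]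
    rw [hsplit, hv, hw, Prod.mk_add_mk, add_zero, zero_add, LinearEquiv.prodCongr_apply]
    rfl
  · rintro ⟨g, hg, rfl⟩
    exact prodCongr_mem_mumfordTateGroup hg

/-- **`Hg(H ⊕ H)(ℚ) = Δ Hg(H)(ℚ)`.** [cite: Moonen1999MTNotes, (1.13)] -/
theorem mem_hodgeGroup_prod_self_iff {g' : (V × V) ≃ₗ[ℚ] (V × V)} :
    g' ∈ (H.prod H).hodgeGroup ↔ ∃ g ∈ H.hodgeGroup, g' = g.prodCongr g := by
  constructor
  · intro hg'
    obtain ⟨g, -, rfl⟩ := mem_mumfordTateGroup_prod_self_iff.1 (hodgeGroup_le_mumfordTateGroup _ hg')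
    exact ⟨g, prodCongr_mem_hodgeGroup_iff.1 hg', rfl⟩
  · rintro ⟨g, hg, rfl⟩
    exact prodCongr_mem_hodgeGroup hg

end RatPoints

end HodgeStructure

end Literature.AlgebraicGeometry.Motives

end
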